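import Summits.Ventures.YMGap.RobustBall.UniformMassGapKR
import Summits.Ventures.YMGap.RobustBall.UniformMassGapZdG
import Summits.Ventures.YMGap.RobustBall.MassGapOnBallZdGRowsDim3
import Summits.Ventures.YMGap.RobustBall.RowsDim3
import HarnessLib

/-!
# Venture YMGap, track ROBUST-BALL (Y2) — `ℤ³` (the YM₃ lane's lattice): the tier-1 ball and ds-2's gauge ball, UNIFORMLY

HONEST FRAMING. WHAT THIS IS: a venture file (cell `pub-ymgap`, track Y2 ROBUST-BALL, seat rb-p1, theorems only), the `d = 3`
companions of `UniformMassGapKR.lean` / `UniformMassGapZdG.lean` (infinite volume `ℤ³`, `SU(2)`, 't Hooft slot `β_W/4`):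
* TIER 1, closed form (sharp pair `(2/3, 2)` on tilt radius `3/10`, `|β_W| ≤ 3/10`): `su2_dim3_uniformMassGapOnBallZd` —
  `3√(4/3)|β_W| e^{ε₀} + e^{ε₀/2}√(2/3) ε₁ ≤ ρ`, `1/2 ≤ ρ < 1 ⇒ UniformMassGapOnBallZd 3 2 (β_W/4) ε₀ ε₁ R ((1−ρ)/max(1,R)) 32`, `_half`
  (`ρ ≤ 1/2`: rate `log 2/max(1,R)`); rows `su2_dim3_uniformRow[_half]`; cells `(β_W; ε₀, ε₁) = (1/8; .2, .1)`: rate `(3/8)/max(1,R)`;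
  `(1/5; .1, .05)`: `(3/16)/max(1,R)`; `(1/10; .1, .05)`: `log 2/max(1,R)`;
* ds-2's GAUGE BALL on `ℤ³` (robust star door, quarter modulus): schema `su2_dim3_uniformMassGapOnBallZdG_star`
  (`… ≤ ρ₀ < 1 ⇒ UniformMassGapOnBallZdG 3 2 (β_W/4) ε₀ ε₁ R (starRate 3 ρ₀/(max R 1 + 4)) 64`); cells at `β_W = 1/4`: quarter radius
  `(57/1000, 57/2000)`: rate `(1/38)/(max R 1 + 4)`; half radius `(57/500, 57/1000)`: `(1/85)/(…)`; and the frontier UP TO `β_W = 1/2` on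
  `(17/500, 17/1000)`: ONE `m > 0` for every `0 ≤ β_W ≤ 1/2`, every `R`, every member (`su2_dim3_uniformStar_upTo_oneHalf`; explicit value tiny).
WHAT THIS IS NOT: lattice strong coupling on `ℤ³`; nothing about `YM₃` in the continuum or a Clay-sense mass gap.
Certificates: `HOME/rb/certs/UNIFORM-RATES-rbp1.md` (addendum ℤ³).
-/

noncomputable section

open MeasureTheory Filter Function ProbabilityTheory Real
open scoped NNReal
open Literature.Probability.LatticeModels
open Literature.Probability.LatticeModels.DobrushinMetric
open Literature.MathematicalPhysics.QuantumLattice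
open Literature.MathematicalPhysics.QuantumFieldTheory hiding ZdEdge Site
open Literature.MathematicalPhysics.QuantumFieldTheory.Balaban1983to89.StrongCouplingDobrushinWindow (OneLinkKRModulus)
open Summit.QuantumFields.BalabanUV.InfraRed.StrongCouplingPoincareDoorSUN (OneLinkPoincareSUN oneLinkPoincareSUN_two_sharp)
open Summit.QuantumFields.BalabanUV.InfraRed.StrongCouplingVarianceDoorSUN (OneLinkVarianceBound)
open Summit.Ventures.YMGap.OneLinkVarianceBoundSU2 (oneLinkVarianceBound_two_threeTenths)
open Summit.Ventures.YMGap.RobustBallDim3 (sqrt_bounds_su2)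
open Summit.Ventures.YMGap.StarResolventDim (Delta gaugeR doorPoly gaugeR_lt_one_of_door)

namespace Summit.Ventures.YMGap.RobustBall

/-! ### Tier 1 on `ℤ³`, closed-form uniform rate -/

/-- **`SU(2)`, `d = 3`, UNIFORM, HYPOTHESIS-FREE** (sharp pair `(2/3, 2)`, tilt radius `3/10`): for `|β_W| ≤ 3/10`,
`3√(4/3)|β_W| e^{ε₀} + e^{ε₀/2}√(2/3) ε₁ ≤ ρ` and `1/2 ≤ ρ < 1`: `UniformMassGapOnBallZd 3 2 (β_W/4) ε₀ ε₁ R ((1−ρ)/max(1,R)) 32`. [folklore] -/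
theorem su2_dim3_uniformMassGapOnBallZd {βW ε₀ ε₁ ρ : ℝ} (R : ℝ) (hβ : |βW| ≤ 3 / 10)
    (hρ : 3 * Real.sqrt (2 / 3 * 2) * |βW| * exp ε₀ + exp (ε₀ / 2) * Real.sqrt (2 / 3) * ε₁ ≤ ρ) (hhalf : 1 / 2 ≤ ρ)
    (hρ1 : ρ < 1) : UniformMassGapOnBallZd 3 2 (βW / 4) ε₀ ε₁ R ((1 - ρ) / max 1 R) 32 := by
  have hP : OneLinkPoincareSUN 2 (3 / 10) (2 / 3) := oneLinkPoincareSUN_two_sharp _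
  have hV : OneLinkVarianceBound 2 (3 / 10) 2 := oneLinkVarianceBound_two_threeTenths
  have h4 : |βW / 4| = |βW| / 4 := by rw [abs_div, abs_of_pos (by norm_num : (0 : ℝ) < 4)]
  have h32 : (16 * ((2 : ℕ) : ℝ) : ℝ) = 32 := by norm_num
  rw [← h32]
  refine uniformMassGapOnBallZd_of_pair_linear (d := 3) (N := 2) (by norm_num) (by norm_num) R (by norm_num) (by norm_num)
    (b := 3 / 10) ?_ (fun B hB => hP B hB) (fun B hB => hV B hB) ?_ hhalf hρ1
  · rw [h4]; push_cast; linarith [abs_nonneg βW]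
  · rw [h4]
    have e : 6 * (((3 : ℕ) : ℝ) - 1) * (|βW| / 4) * (exp ε₀ * Real.sqrt (2 / 3 * 2)) =
        3 * Real.sqrt (2 / 3 * 2) * |βW| * exp ε₀ := by push_cast; ring
    rw [e]
    exact hρ

/-- The same below one half: `… ≤ 1/2 ⇒` rate `log 2/max(1,R)`, constant `32`. [folklore] -/
theorem su2_dim3_uniformMassGapOnBallZd_half {βW ε₀ ε₁ : ℝ} (R : ℝ) (hβ : |βW| ≤ 3 / 10)
    (hρ : 3 * Real.sqrt (2 / 3 * 2) * |βW| * exp ε₀ + exp (ε₀ / 2) * Real.sqrt (2 / 3) * ε₁ ≤ 1 / 2) :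
    UniformMassGapOnBallZd 3 2 (βW / 4) ε₀ ε₁ R (Real.log 2 / max 1 R) 32 := by
  have hP : OneLinkPoincareSUN 2 (3 / 10) (2 / 3) := oneLinkPoincareSUN_two_sharp _
  have hV : OneLinkVarianceBound 2 (3 / 10) 2 := oneLinkVarianceBound_two_threeTenths
  have h4 : |βW / 4| = |βW| / 4 := by rw [abs_div, abs_of_pos (by norm_num : (0 : ℝ) < 4)]
  have h32 : (16 * ((2 : ℕ) : ℝ) : ℝ) = 32 := by norm_num
  rw [← h32]
  refine uniformMassGapOnBallZd_of_pair_half (d := 3) (N := 2) (by norm_num) (by norm_num) R (by norm_num) (by norm_num)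
    (b := 3 / 10) ?_ (fun B hB => hP B hB) (fun B hB => hV B hB) ?_ le_rfl
  · rw [h4]; push_cast; linarith [abs_nonneg βW]
  · rw [h4]
    have e : 6 * (((3 : ℕ) : ℝ) - 1) * (|βW| / 4) * (exp ε₀ * Real.sqrt (2 / 3 * 2)) =
        3 * Real.sqrt (2 / 3 * 2) * |βW| * exp ε₀ := by push_cast; ring
    rw [e]
    exact hρ

/-- **`ℤ³` uniform row from the rational certificate** (`√(4/3) ≤ 1.1548`, `√(2/3) ≤ 0.8165`, `T` = `exp_le_taylor4`): `0 ≤ β_W ≤ 3/10`,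
`0 ≤ ε ≤ 1/2`, `3·1.1548·β_W·T(2ε) + T(ε)·0.8165·ε ≤ ρ`, `1/2 ≤ ρ < 1 ⇒ UniformMassGapOnBallZd 3 2 (β_W/4) (2ε) ε R ((1−ρ)/max(1,R)) 32`. [folklore] -/
theorem su2_dim3_uniformRow (R : ℝ) {βW ε ρ : ℝ} (hβ0 : 0 ≤ βW) (hβ : βW ≤ 3 / 10) (hε0 : 0 ≤ ε) (hε1 : ε ≤ 1 / 2)
    (hcert : 3 * 1.1548 * βW * (1 + 2 * ε + (2 * ε) ^ 2 / 2 + (2 * ε) ^ 3 / 6 + 5 / 96 * (2 * ε) ^ 4) +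
      (1 + ε + ε ^ 2 / 2 + ε ^ 3 / 6 + 5 / 96 * ε ^ 4) * 0.8165 * ε ≤ ρ) (hhalf : 1 / 2 ≤ ρ) (hρ1 : ρ < 1) :
    UniformMassGapOnBallZd 3 2 (βW / 4) (2 * ε) ε R ((1 - ρ) / max 1 R) 32 := by
  refine su2_dim3_uniformMassGapOnBallZd R (by rw [abs_of_nonneg hβ0]; exact hβ) ?_ hhalf hρ1
  rw [abs_of_nonneg hβ0]
  have hT2 := exp_le_taylor4 (x := 2 * ε) (by linarith) (by linarith)
  have hT1 := exp_le_taylor4 (x := ε) hε0 (by linarith)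
  have e2 : (2 * ε) / 2 = ε := by ring
  rw [e2]
  obtain ⟨hs23, hs43⟩ := sqrt_bounds_su2
  have hA : 3 * Real.sqrt (2 / 3 * 2) * βW * exp (2 * ε) ≤
      3 * 1.1548 * βW * (1 + 2 * ε + (2 * ε) ^ 2 / 2 + (2 * ε) ^ 3 / 6 + 5 / 96 * (2 * ε) ^ 4) :=
    mul_le_mul (mul_le_mul_of_nonneg_right (mul_le_mul_of_nonneg_left hs43 (by norm_num)) hβ0) hT2 (exp_pos _).le
      (by positivity)
  have hB : exp ε * Real.sqrt (2 / 3) * ε ≤ (1 + ε + ε ^ 2 / 2 + ε ^ 3 / 6 + 5 / 96 * ε ^ 4) * 0.8165 * ε :=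
    mul_le_mul_of_nonneg_right (mul_le_mul hT1 hs23 (Real.sqrt_nonneg _) (by positivity)) hε0
  linarith

/-- The same below one half. [folklore] -/
theorem su2_dim3_uniformRow_half (R : ℝ) {βW ε : ℝ} (hβ0 : 0 ≤ βW) (hβ : βW ≤ 3 / 10) (hε0 : 0 ≤ ε) (hε1 : ε ≤ 1 / 2)
    (hcert : 3 * 1.1548 * βW * (1 + 2 * ε + (2 * ε) ^ 2 / 2 + (2 * ε) ^ 3 / 6 + 5 / 96 * (2 * ε) ^ 4) +
      (1 + ε + ε ^ 2 / 2 + ε ^ 3 / 6 + 5 / 96 * ε ^ 4) * 0.8165 * ε ≤ 1 / 2) :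
    UniformMassGapOnBallZd 3 2 (βW / 4) (2 * ε) ε R (Real.log 2 / max 1 R) 32 := by
  refine su2_dim3_uniformMassGapOnBallZd_half R (by rw [abs_of_nonneg hβ0]; exact hβ) ?_
  rw [abs_of_nonneg hβ0]
  have hT2 := exp_le_taylor4 (x := 2 * ε) (by linarith) (by linarith)
  have hT1 := exp_le_taylor4 (x := ε) hε0 (by linarith)
  have e2 : (2 * ε) / 2 = ε := by ring
  rw [e2]
  obtain ⟨hs23, hs43⟩ := sqrt_bounds_su2
  have hA : 3 * Real.sqrt (2 / 3 * 2) * βW * exp (2 * ε) ≤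
      3 * 1.1548 * βW * (1 + 2 * ε + (2 * ε) ^ 2 / 2 + (2 * ε) ^ 3 / 6 + 5 / 96 * (2 * ε) ^ 4) :=
    mul_le_mul (mul_le_mul_of_nonneg_right (mul_le_mul_of_nonneg_left hs43 (by norm_num)) hβ0) hT2 (exp_pos _).le
      (by positivity)
  have hB : exp ε * Real.sqrt (2 / 3) * ε ≤ (1 + ε + ε ^ 2 / 2 + ε ^ 3 / 6 + 5 / 96 * ε ^ 4) * 0.8165 * ε :=
    mul_le_mul_of_nonneg_right (mul_le_mul hT1 hs23 (Real.sqrt_nonneg _) (by positivity)) hε0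
  linarith

/-- **`ℤ³` cell `(β_W; ε₀, ε₁) = (1/8; 1/5, 1/10)`**: row sum `≤ 5/8` ⇒ rate `(3/8)/max(1,R)`, constant `32`. [folklore] -/
theorem su2_dim3_uniformRow_1_8 (R : ℝ) :
    UniformMassGapOnBallZd 3 2 ((1 / 8 : ℝ) / 4) (2 * (1 / 10)) (1 / 10) R ((1 - 5 / 8) / max 1 R) 32 :=
  su2_dim3_uniformRow R (by norm_num) (by norm_num) (by norm_num) (by norm_num) (by norm_num) (by norm_num) (by norm_num)

/-- **`ℤ³` cell `(β_W; ε₀, ε₁) = (1/5; 1/10, 1/20)`**: row sum `≤ 13/16` ⇒ rate `(3/16)/max(1,R)`, constant `32`. [folklore] -/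
theorem su2_dim3_uniformRow_1_5 (R : ℝ) :
    UniformMassGapOnBallZd 3 2 ((1 / 5 : ℝ) / 4) (2 * (1 / 20)) (1 / 20) R ((1 - 13 / 16) / max 1 R) 32 :=
  su2_dim3_uniformRow R (by norm_num) (by norm_num) (by norm_num) (by norm_num) (by norm_num) (by norm_num) (by norm_num)

/-- **`ℤ³` cell `(β_W; ε₀, ε₁) = (1/10; 1/10, 1/20)`**: row sum `≤ 1/2` ⇒ rate `log 2/max(1,R)`, constant `32`. [folklore] -/
theorem su2_dim3_uniformRow_1_10_half (R : ℝ) :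
    UniformMassGapOnBallZd 3 2 ((1 / 10 : ℝ) / 4) (2 * (1 / 20)) (1 / 20) R (Real.log 2 / max 1 R) 32 :=
  su2_dim3_uniformRow_half R (by norm_num) (by norm_num) (by norm_num) (by norm_num) (by norm_num)

/-! ### ds-2's gauge ball on `ℤ³`, uniformly -/

/-- **SCHEMA, `SU(2)`, `d = 3`, robust star door on `ℤ³`, UNIFORM** (ds-2's `su2_massGapOnBallZdG_dim3_star` with constants exposed):
`e^{ε₀} ≤ E`, `√2 ≤ S`, `c ≥ E(1 + 2Sε₁)β_W/4`, `λ ≥ Sε₁`, `doorPoly 3 c < 1`, `4c + λ < 1`,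
`gaugeR 3 c + (λ + (4c+λ)^Kn·12λ)/(1 − (4c+λ)) ≤ ρ₀ < 1 ⇒ UniformMassGapOnBallZdG 3 2 (β_W/4) ε₀ ε₁ R (starRate 3 ρ₀/(max R 1 + 4)) 64`.
[folklore] -/
theorem su2_dim3_uniformMassGapOnBallZdG_star (Kn : ℕ) {βW ε₀ ε₁ c lam E S ρ₀ : ℝ} (hβ0 : 0 ≤ βW) (hβ : βW ≤ 2 / 3)
    (hε₁ : 0 ≤ ε₁) (hE : Real.exp ε₀ ≤ E) (hS : Real.sqrt 2 ≤ S) (hc : E * (1 + 2 * S * ε₁) * (βW / 4) ≤ c)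
    (hlam : S * ε₁ ≤ lam) (hθ1 : 4 * c + lam < 1) (hcd : doorPoly 3 c < 1)
    (hρ0 : gaugeR 3 c + (lam + (4 * c + lam) ^ Kn * (12 * lam)) / (1 - (4 * c + lam)) ≤ ρ₀) (hρ1 : ρ₀ < 1) (R : ℕ) :
    UniformMassGapOnBallZdG 3 2 (βW / 4) ε₀ ε₁ R (starRate 3 ρ₀ / (max R 1 + 4 : ℕ)) 64 := by
  have hS0 : 0 ≤ S := (Real.sqrt_nonneg _).trans hS
  have hE0 : 0 ≤ E := (Real.exp_pos _).le.trans hE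
  set θ : ℝ := 4 * c + lam with hθ
  set ρ : ℝ := gaugeR 3 c + (lam + θ ^ Kn * (12 * lam)) / (1 - θ) with hρ
  have habs : |((2 : ℕ) : ℝ) * (βW / 4)| / ((2 : ℕ) : ℝ) = βW / 4 := by
    rw [abs_of_nonneg (by positivity)]
    push_cast
    ring
  have hR : |((2 : ℕ) : ℝ) * (βW / 4)| / ((2 : ℕ) : ℝ) * (2 * (((3 : ℕ) : ℝ) - 1)) ≤ 3 * βW / 2 := by
    rw [habs]; push_cast; linarith
  have hc' : (1 : ℝ) * Real.exp ε₀ * (1 + 2 * Real.sqrt ((2 : ℕ) : ℝ) * ε₁) *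
      (|((2 : ℕ) : ℝ) * (βW / 4)| / ((2 : ℕ) : ℝ)) ≤ c := by
    refine le_trans ?_ hc
    have h1 : Real.sqrt ((2 : ℕ) : ℝ) = Real.sqrt 2 := by norm_num
    rw [h1, one_mul, habs]
    have hb : 0 ≤ βW / 4 := by positivity
    calc Real.exp ε₀ * (1 + 2 * Real.sqrt 2 * ε₁) * (βW / 4) ≤ E * (1 + 2 * Real.sqrt 2 * ε₁) * (βW / 4) := by
          gcongr
      _ ≤ E * (1 + 2 * S * ε₁) * (βW / 4) := by gcongr
  have hlam' : Real.sqrt ((2 : ℕ) : ℝ) * ε₁ ≤ lam := by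
    have h1 : Real.sqrt ((2 : ℕ) : ℝ) = Real.sqrt 2 := by norm_num
    rw [h1]; exact le_trans (mul_le_mul_of_nonneg_right hS hε₁) hlam
  have hθ' : θ = (2 * ((3 : ℕ) : ℝ) - 2) * c + lam := by rw [hθ]; push_cast; ring
  have hρ' : ρ = gaugeR 3 c + (lam + θ ^ Kn * (4 * ((3 : ℕ) : ℝ) * lam)) / (1 - θ) := by rw [hρ]; push_cast; ring
  have h64 : (32 * ((2 : ℕ) : ℝ) : ℝ) = 64 := by norm_num
  rw [← h64]
  exact uniformMassGapOnBallZdG_of_robustStar (d := 3) (N := 2) (by norm_num) (by norm_num) zero_le_one hR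
    (su2_quarterModulus hβ) hε₁ hc' hlam' hθ' hθ1 hcd hρ' hρ0 hρ1

/-- **`ℤ³` CELL `β_W = 1/4`, QUARTER RADIUS `(57/1000, 57/2000)`**: received sum `≤ 43/100` ⇒
`UniformMassGapOnBallZdG 3 2 (1/16) (57/1000) (57/2000) R ((1/38)/(max R 1 + 4)) 64` (certificate `c = 143/2000`, `λ = 20153/500000`). [folklore] -/
theorem su2_dim3_uniformStar_oneQuarter_quarterRadius (R : ℕ) :
    UniformMassGapOnBallZdG 3 2 (1 / 16) (57 / 1000) (57 / 2000) R ((1 / 38 : ℝ) / (max R 1 + 4 : ℕ)) 64 := by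
  have e1 : (1 / 4 : ℝ) / 4 = 1 / 16 := by norm_num
  have h := su2_dim3_uniformMassGapOnBallZdG_star 20 (βW := 1 / 4) (ε₀ := 57 / 1000) (ε₁ := 57 / 2000)
    (c := 143 / 2000) (lam := 20153 / 500000) (ρ₀ := 43 / 100) (by norm_num) (by norm_num) (by norm_num)
    (exp_le_taylor4 (x := 57 / 1000) (by norm_num) (by norm_num)) sqrt_two_le (by norm_num) (by norm_num)
    (by norm_num) (by unfold doorPoly; norm_num) (by unfold gaugeR Delta; norm_num) (by norm_num) R
  rw [e1] at h
  have hrate : (1 / 38 : ℝ) ≤ starRate 3 (43 / 100) := by unfold starRate; norm_num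
  have hD : (0 : ℝ) < ((max R 1 + 4 : ℕ) : ℝ) := by positivity
  exact h.mono le_rfl le_rfl le_rfl (by positivity) (div_le_div_of_nonneg_right hrate hD.le) le_rfl (by norm_num)

/-- **`ℤ³` CELL `β_W = 1/4`, HALF RADIUS `(57/500, 57/1000)`**: received sum `≤ 57/100` ⇒ rate `(1/85)/(max R 1 + 4)`, constant `64`
(certificate `c = 81341/1000000`, `λ = 80611/1000000`). [folklore] -/
theorem su2_dim3_uniformStar_oneQuarter_halfRadius (R : ℕ) :
    UniformMassGapOnBallZdG 3 2 (1 / 16) (57 / 500) (57 / 1000) R ((1 / 85 : ℝ) / (max R 1 + 4 : ℕ)) 64 := by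
  have e1 : (1 / 4 : ℝ) / 4 = 1 / 16 := by norm_num
  have h := su2_dim3_uniformMassGapOnBallZdG_star 20 (βW := 1 / 4) (ε₀ := 57 / 500) (ε₁ := 57 / 1000)
    (c := 81341 / 1000000) (lam := 80611 / 1000000) (ρ₀ := 57 / 100) (by norm_num) (by norm_num) (by norm_num)
    (exp_le_taylor4 (x := 57 / 500) (by norm_num) (by norm_num)) sqrt_two_le (by norm_num) (by norm_num)
    (by norm_num) (by unfold doorPoly; norm_num) (by unfold gaugeR Delta; norm_num) (by norm_num) R
  rw [e1] at h
  have hrate : (1 / 85 : ℝ) ≤ starRate 3 (57 / 100) := by unfold starRate; norm_num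
  have hD : (0 : ℝ) < ((max R 1 + 4 : ℕ) : ℝ) := by positivity
  exact h.mono le_rfl le_rfl le_rfl (by positivity) (div_le_div_of_nonneg_right hrate hD.le) le_rfl (by norm_num)

/-- **`ℤ³`, UP TO `β_W = 1/2`, uniformly on the frontier ball `(17/500, 17/1000)`**: ONE `m > 0` for every `0 ≤ β_W ≤ 1/2`, every range,
every member and every DLR state (ds-2's `su2_massGapOnBallZdG_dim3_star_upTo_oneHalf` certificate; explicit value tiny — recorded only). [folklore] -/
theorem su2_dim3_uniformStar_upTo_oneHalf :
    ∃ m : ℝ, 0 < m ∧ ∀ βW : ℝ, 0 ≤ βW → βW ≤ 1 / 2 → ∀ R : ℕ,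
      UniformMassGapOnBallZdG 3 2 (βW / 4) (17 / 500) (17 / 1000) R (m / (max R 1 + 4 : ℕ)) 64 := by
  set ρ₀ : ℝ := gaugeR 3 (67771 / 500000) +
    (12021 / 500000 + (4 * (67771 / 500000) + 12021 / 500000) ^ 20 * (12 * (12021 / 500000))) /
      (1 - (4 * (67771 / 500000) + 12021 / 500000)) with hρ₀
  have hρ1 : ρ₀ < 1 := by rw [hρ₀]; unfold gaugeR Delta; norm_num
  have hρ00 : 0 ≤ ρ₀ := by rw [hρ₀]; unfold gaugeR Delta; norm_num
  refine ⟨starRate 3 ρ₀, starRate_pos hρ00 hρ1, fun βW h0 h R => ?_⟩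
  refine su2_dim3_uniformMassGapOnBallZdG_star 20 (ε₀ := 17 / 500) (ε₁ := 17 / 1000) (c := 67771 / 500000)
    (lam := 12021 / 500000) (E := 206917 / 200000) (S := 1.41422) h0 (h.trans (by norm_num)) (by norm_num)
    exp_le_17_500_star sqrt_two_le ?_ (by norm_num) (by norm_num) (by unfold doorPoly; norm_num) le_rfl hρ1 R
  calc (206917 / 200000 : ℝ) * (1 + 2 * 1.41422 * (17 / 1000)) * (βW / 4)
      ≤ 206917 / 200000 * (1 + 2 * 1.41422 * (17 / 1000)) * ((1 / 2) / 4) := by gcongr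
    _ ≤ 67771 / 500000 := by norm_num

end Summit.Ventures.YMGap.RobustBall

end
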